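import Literature.AnabelianGeometry.SemiGraphs.Coverticial
import Literature.AnabelianGeometry.SemiGraphs.CoveringLift

/-!
# Aligned local data of a finite étale covering and the lift `B(𝒦)_{/A} ⥤ B(ℋ)` ([SemiAnbd] §2, Def. 2.2 (i))

Mochizuki, *Semi-graphs of anabelioids*, Publ. RIMS **42** (2006) 221–322, §2, Definition 2.2 (i)
and the paragraph before it, author's manuscript p. 23 [cite: MochizukiSemiAnbd2006, Def. 2.2(i) p.23]:
the finite étale covering `𝒢' → 𝒢` attached to `G' ∈ Ob(B(𝒢))` is CONSTRUCTED — vertices over `v`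
are the components of `S_v`, the constituent at such a vertex is the component anabelioid
`(𝒢_v)_P`, and "`B' = B(𝒢)_{G'}` … arises naturally as the `B(−)` of … `𝒢'`".

abc-iut cell, layer L3, row «COMP-LOCAL» (lead α-08:58:27Z; FACT-LIST F-1478 residual «print's
finite étale coverings compose», holder abc-iut-f-161).  The cell's covering notion of record
`Hom.IsFiniteEtaleCoveringGlobal` (`Coverticial.lean`) is «local ∧ global ∧ branch-aligned ∧
vertex-aligned», each clause an `∃`.  The LOCAL clause of a COMPOSITE `𝒢 → ℋ → 𝒦` needs more than
the separate `∃`-witnesses of `ψ : ℋ → 𝒦`: the object of `B(ℋ)` to which `𝒢 → ℋ` is attached must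
be glued, inside `ℋ`, the way print's construction glues — through `ψ`'s local equivalences.  This
DEFINITIONS file packages exactly that (data, no named `Prop` fact):

* `Hom.AlignedLocalData ψ A` — `ψ`'s local witnesses AS DATA (component labels `cV`, `cE` with the
  two bijectivity clauses, local equivalences `αV_w : (𝒦_u)_{/P_w} ⥤ ℋ_w`, `αE_f` with
  `ψ_w^* ≅ (P_w × −) ⋙ αV_w`, edge data indexed by a PRESENTATION `(f, e₀, ψ f = e₀)` of the image
  edge as in `Hom.φE`) together with FUNCTOR-LEVEL branch alignment: for a branch `b₁` of `ℋ` at `w`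
  over `b₀` at `u`, `αV_w ⋙ b₁^* ≅ (X ↦ b₀^* X ×_{b₀^* P} Q) ⋙ αE` — the gluing functor of print's
  construction (`BObj.gluingFunctor`, `CoveringOfObject.lean`) read through the local equivalences;
* `AlignedLocalData.pieceV/pieceE` — `(X → A) ↦ (X_u ×_{A_u} P_w → P_w)`, resp. edges (the
  components of the comparison functor `B(𝒦)_{/A} ⥤ B(𝒦_A)` of `CoveringComparison.lean`, for
  ARBITRARY component labels);
* `AlignedLocalData.isPullback_glue`, `glueIso` — `b₀^*(X_u ×_{A_u} P) ×_{b₀^* P} Q ≅ X_{e₀} ×_{A_{e₀}} Q`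
  naturally in `X` (verbatim the gluing square `BObj.isPullback_glue`, for arbitrary labels);
* `AlignedLocalData.lift 𝔇 : Over A ⥤ ℋ.BObj` — **the lift**: `(X → A) ↦ {αV_w (X_u ×_{A_u} P_w),
  αE_f (X_e ×_{A_e} Q_f)}` glued by the branch isomorphisms `β` and `X`'s own gluing (print's
  "`B(𝒢)_{G'}` arises as the `B(−)` of `𝒢'`", for an ABSTRACT covering with aligned local data).

For print's construction `ψ = coveringHomCan A` the data are the `Shrink` models with identity
isomorphisms and `lift` is `BObj.toCovering A`; that every covering in print's sense carries such
data with `lift` an equivalence `≅`-compatible with `ψ^*` is the comparison theorem behind Bass's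
covering theory of graphs of groups (the honest form of the residual of F-1478) and is NOT claimed
here.  Consumer: `FiniteEtaleCoveringCompLocal.lean` (the local clause of a composite attached to
`lift 𝔇 X` is the local clause over `X`).  Nothing here takes a side on [IUTchIII] Cor. 3.12.
-/

namespace Literature.AnabelianGeometry.SemiGraphs

open CategoryTheory CategoryTheory.Limits CategoryTheory.PreGaloisCategory
open Literature.AnabelianGeometry.Anabelioids

universe v₁ u₁ u

-- Mathlib's `Over.pullback` / `Over.post` simp lemmas (`pullback.lift_fst`, …) only fire under the
-- pre-v4.2x defeq transparency behaviour, exactly as in `Mathlib/CategoryTheory/Comma/Over/Pullback.lean`.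
set_option backward.isDefEq.respectTransparency false

namespace SemiGraphOfAnabelioids

variable {ℋ 𝒦 : SemiGraphOfAnabelioids.{v₁, u₁, u}}

/-- **Aligned local data** of a morphism `ψ : ℋ → 𝒦` over an object `A ∈ B(𝒦)` ([SemiAnbd] Def. 2.2
(i), p. 23, the construction of the covering attached to `A`): the witnesses of the local description
`Hom.IsFiniteEtaleCoveringOf ψ A` as DATA — labels `cV w ⊆ A_{ψ w}`, `cE f ⊆ A_{ψ f}` (components;
vertices/edges of `ℋ` over `u`/`e` in bijection with the components of `A_u`/`A_e`), local
equivalences `αV_w : (𝒦_u)_{/P_w} ⥤ ℋ_w`, `αE_f` with `ψ_w^* ≅ (P_w × −) ⋙ αV_w` (edge data indexed by a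
presentation `ψ f = e₀` of the image edge, as `Hom.φE`) — PLUS the position of the edge labels under
the vertex labels (`le_branchImage`, print: the component of `T_e` "lies under" that of `S_v` via
`ψ_b`) and FUNCTOR-LEVEL branch alignment `β`: the branch functor `b₁^*` of `ℋ` is, through the local
equivalences, print's gluing functor `X ↦ b₀^* X ×_{b₀^* P} Q` (`BObj.gluingFunctor`).
[cite: MochizukiSemiAnbd2006, Def. 2.2(i) p.23] -/
structure Hom.AlignedLocalData (ψ : Hom ℋ 𝒦) (A : 𝒦.BObj) where
  /-- the component `P_w ⊆ A_{ψ w}` labelled by the vertex `w` -/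
  cV : ∀ w : ℋ.graph.Vertex, π₀Obj (A.S (ψ.base.vertexMap w))
  /-- the component `Q_f ⊆ A_{e₀}` labelled by the edge `f`, for a presentation `ψ f = e₀` -/
  cE : ∀ (f : ℋ.graph.Edge) (e₀ : 𝒦.graph.Edge), ψ.base.edgeMap f = e₀ → π₀Obj (A.T e₀)
  /-- vertices of `ℋ` over `u` ↔ components of `A_u` -/
  cV_bijective : Function.Bijective
    (fun w : ℋ.graph.Vertex => (⟨ψ.base.vertexMap w, cV w⟩ : Σ u, π₀Obj (A.S u)))
  /-- edges of `ℋ` over `e` ↔ components of `A_e` -/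
  cE_bijective : Function.Bijective
    (fun f : ℋ.graph.Edge => (⟨ψ.base.edgeMap f, cE f _ rfl⟩ : Σ e, π₀Obj (A.T e)))
  /-- the local equivalence `(𝒦_u)_{/P_w} ⥤ ℋ_w` at a vertex -/
  αV : ∀ w : ℋ.graph.Vertex, Over ((cV w).1 : 𝒦.V (ψ.base.vertexMap w)) ⥤ ℋ.V w
  /-- … is an equivalence -/
  αV_isEquivalence : ∀ w, (αV w).IsEquivalence
  /-- `ψ_w^* ≅ (P_w × −) ⋙ αV_w` -/
  εV : ∀ w, (ψ.φV w).pullback ≅ Over.star ((cV w).1 : 𝒦.V (ψ.base.vertexMap w)) ⋙ αV w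
  /-- the local equivalence `(𝒦_{e₀})_{/Q_f} ⥤ ℋ_f` at an edge (presentation `ψ f = e₀`) -/
  αE : ∀ (f : ℋ.graph.Edge) (e₀ : 𝒦.graph.Edge) (p : ψ.base.edgeMap f = e₀),
    Over ((cE f e₀ p).1 : 𝒦.E e₀) ⥤ ℋ.E f
  /-- … is an equivalence -/
  αE_isEquivalence : ∀ f e₀ p, (αE f e₀ p).IsEquivalence
  /-- `ψ_f^* ≅ (Q_f × −) ⋙ αE_f` -/
  εE : ∀ f e₀ p, (ψ.φE f e₀ p).pullback ≅ Over.star ((cE f e₀ p).1 : 𝒦.E e₀) ⋙ αE f e₀ p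
  /-- the edge label of the edge of a branch `b₁` at `w` lies under the vertex label of `w` via the
  gluing `ψ_{b₀}` of `A`, `b₀ := ψ b₁` -/
  le_branchImage : ∀ (b₁ : ℋ.graph.Branch) (w : ℋ.graph.Vertex) (h₁ : ℋ.graph.abuts b₁ = some w),
    (cE (ℋ.graph.edgeOf b₁) (𝒦.graph.edgeOf (ψ.base.branchMap b₁))
        (ψ.base.edgeOf_branchMap b₁).symm).1 ≤
      A.branchImage (ψ.base.branchMap b₁) (ψ.base.vertexMap w) (ψ.base.abuts_branchMap b₁ w h₁)
        (cV w).1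
  /-- functor-level branch alignment: `αV_w ⋙ b₁^* ≅ (X ↦ b₀^* X ×_{b₀^* P} Q) ⋙ αE` -/
  β : ∀ (b₁ : ℋ.graph.Branch) (w : ℋ.graph.Vertex) (h₁ : ℋ.graph.abuts b₁ = some w),
    αV w ⋙ (ℋ.pull b₁ w h₁).pullback ≅
      A.gluingFunctor (ψ.base.abuts_branchMap b₁ w h₁) (cV w).1
          (cE (ℋ.graph.edgeOf b₁) (𝒦.graph.edgeOf (ψ.base.branchMap b₁))
            (ψ.base.edgeOf_branchMap b₁).symm).1 (le_branchImage b₁ w h₁) ⋙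
        αE (ℋ.graph.edgeOf b₁) (𝒦.graph.edgeOf (ψ.base.branchMap b₁)) (ψ.base.edgeOf_branchMap b₁).symm

namespace Hom.AlignedLocalData

variable {ψ : Hom ℋ 𝒦} {A : 𝒦.BObj} (𝔇 : ψ.AlignedLocalData A)

/-! ### Presentations of the image edge -/

/-- Edge labels at two presentations of the image edge agree (any family indexed by `(e₀, ψ f = e₀)`
is determined by its value at the canonical presentation). [cite: MochizukiSemiAnbd2006, Def. 2.2(i) p.23] -/
theorem cE_eq_cast (f : ℋ.graph.Edge) (e₀ : 𝒦.graph.Edge) (p : ψ.base.edgeMap f = e₀) :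
    𝔇.cE f e₀ p = p ▸ 𝔇.cE f _ rfl := by
  subst p; rfl

/-- The edge label of a branch's edge, as a point of `Σ e, π₀(A_e)`, is the canonical one.
[cite: MochizukiSemiAnbd2006, Def. 2.2(i) p.23] -/
theorem sigma_mk_cE (f : ℋ.graph.Edge) (e₀ : 𝒦.graph.Edge) (p : ψ.base.edgeMap f = e₀) :
    (⟨e₀, 𝔇.cE f e₀ p⟩ : Σ e, π₀Obj (A.T e)) = ⟨ψ.base.edgeMap f, 𝔇.cE f _ rfl⟩ := by
  subst p; rfl

/-! ### The pieces `X_u ×_{A_u} P_w`, `X_e ×_{A_e} Q_f` -/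

/-- The vertex piece functor `(X → A) ↦ (X_u ×_{A_u} P_w → P_w)`, `u = ψ w`.
[cite: MochizukiSemiAnbd2006, Def. 2.2(i) p.23] -/
noncomputable def pieceV (w : ℋ.graph.Vertex) :
    Over A ⥤ Over ((𝔇.cV w).1 : 𝒦.V (ψ.base.vertexMap w)) :=
  Over.post (𝒦.ρ (ψ.base.vertexMap w)) ⋙ Over.pullback (𝔇.cV w).1.arrow

/-- The edge piece functor `(X → A) ↦ (X_{e₀} ×_{A_{e₀}} Q_f → Q_f)` at a presentation `ψ f = e₀`.
[cite: MochizukiSemiAnbd2006, Def. 2.2(i) p.23] -/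
noncomputable def pieceE (f : ℋ.graph.Edge) (e₀ : 𝒦.graph.Edge) (p : ψ.base.edgeMap f = e₀) :
    Over A ⥤ Over ((𝔇.cE f e₀ p).1 : 𝒦.E e₀) :=
  Over.post (𝒦.ρE e₀) ⋙ Over.pullback (𝔇.cE f e₀ p).1.arrow

/-- First projection of `pieceV` on morphisms. [cite: MochizukiSemiAnbd2006, Def. 2.2(i) p.23] -/
@[reassoc] theorem pieceV_map_left_fst {X Y : Over A} (g : X ⟶ Y) (w : ℋ.graph.Vertex) :
    ((𝔇.pieceV w).map g).left ≫ pullback.fst _ _ =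
      pullback.fst _ _ ≫ g.left.fS (ψ.base.vertexMap w) := by
  simp [pieceV, Over.pullback_map_left]

/-- Second projection of `pieceV` on morphisms. [cite: MochizukiSemiAnbd2006, Def. 2.2(i) p.23] -/
@[reassoc] theorem pieceV_map_left_snd {X Y : Over A} (g : X ⟶ Y) (w : ℋ.graph.Vertex) :
    ((𝔇.pieceV w).map g).left ≫ pullback.snd _ _ = pullback.snd _ _ := by
  simp [pieceV, Over.pullback_map_left]

/-- First projection of `pieceE` on morphisms. [cite: MochizukiSemiAnbd2006, Def. 2.2(i) p.23] -/
@[reassoc] theorem pieceE_map_left_fst {X Y : Over A} (g : X ⟶ Y) (f : ℋ.graph.Edge)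
    (e₀ : 𝒦.graph.Edge) (p : ψ.base.edgeMap f = e₀) :
    ((𝔇.pieceE f e₀ p).map g).left ≫ pullback.fst _ _ = pullback.fst _ _ ≫ g.left.fT e₀ := by
  simp [pieceE, Over.pullback_map_left]

/-- Second projection of `pieceE` on morphisms. [cite: MochizukiSemiAnbd2006, Def. 2.2(i) p.23] -/
@[reassoc] theorem pieceE_map_left_snd {X Y : Over A} (g : X ⟶ Y) (f : ℋ.graph.Edge)
    (e₀ : 𝒦.graph.Edge) (p : ψ.base.edgeMap f = e₀) :
    ((𝔇.pieceE f e₀ p).map g).left ≫ pullback.snd _ _ = pullback.snd _ _ := by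
  simp [pieceE, Over.pullback_map_left]

/-! ### The gluing functor and the gluing square along a branch -/

section Branch

variable (b₁ : ℋ.graph.Branch) (w : ℋ.graph.Vertex) (h₁ : ℋ.graph.abuts b₁ = some w)

/-- Print's gluing functor `X ↦ b₀^* X ×_{b₀^* P_w} Q` along the branch `b₁` at `w` (`b₀ = ψ b₁`),
between the slices labelled by `𝔇`. [cite: MochizukiSemiAnbd2006, Def. 2.2(i) p.23] -/
noncomputable def gluingAt :
    Over ((𝔇.cV w).1 : 𝒦.V (ψ.base.vertexMap w)) ⥤
      Over ((𝔇.cE (ℋ.graph.edgeOf b₁) (𝒦.graph.edgeOf (ψ.base.branchMap b₁))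
        (ψ.base.edgeOf_branchMap b₁).symm).1 : 𝒦.E (𝒦.graph.edgeOf (ψ.base.branchMap b₁))) :=
  A.gluingFunctor (ψ.base.abuts_branchMap b₁ w h₁) (𝔇.cV w).1
    (𝔇.cE (ℋ.graph.edgeOf b₁) (𝒦.graph.edgeOf (ψ.base.branchMap b₁))
      (ψ.base.edgeOf_branchMap b₁).symm).1 (𝔇.le_branchImage b₁ w h₁)

/-- First projection of the gluing functor on morphisms. [cite: MochizukiSemiAnbd2006, Def. 2.2(i) p.23] -/
@[reassoc] theorem gluingAt_map_left_fst {U U' : Over ((𝔇.cV w).1 : 𝒦.V (ψ.base.vertexMap w))}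
    (g : U ⟶ U') :
    ((𝔇.gluingAt b₁ w h₁).map g).left ≫ pullback.fst _ _ =
      pullback.fst _ _ ≫ (𝒦.pull (ψ.base.branchMap b₁) (ψ.base.vertexMap w)
        (ψ.base.abuts_branchMap b₁ w h₁)).pullback.map g.left := by
  simp [gluingAt, Over.pullback_map_left]

/-- Second projection of the gluing functor on morphisms. [cite: MochizukiSemiAnbd2006, Def. 2.2(i) p.23] -/
@[reassoc] theorem gluingAt_map_left_snd {U U' : Over ((𝔇.cV w).1 : 𝒦.V (ψ.base.vertexMap w))}
    (g : U ⟶ U') :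
    ((𝔇.gluingAt b₁ w h₁).map g).left ≫ pullback.snd _ _ = pullback.snd _ _ := by
  simp [gluingAt, Over.pullback_map_left]

/-- The edge piece over the edge OF THE BRANCH `b₀ = ψ b₁` (presentation `ψ (edgeOf b₁) = edgeOf b₀`).
[cite: MochizukiSemiAnbd2006, Def. 2.2(i) p.23] -/
noncomputable abbrev pieceBr :
    Over A ⥤ Over ((𝔇.cE (ℋ.graph.edgeOf b₁) (𝒦.graph.edgeOf (ψ.base.branchMap b₁))
      (ψ.base.edgeOf_branchMap b₁).symm).1 : 𝒦.E (𝒦.graph.edgeOf (ψ.base.branchMap b₁))) :=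
  𝔇.pieceE (ℋ.graph.edgeOf b₁) (𝒦.graph.edgeOf (ψ.base.branchMap b₁)) (ψ.base.edgeOf_branchMap b₁).symm

/-- **The gluing square** (verbatim `BObj.isPullback_glue` of `CoveringComparison.lean` for arbitrary
labels): `b₀^*(X_u ×_{A_u} P) ×_{b₀^* P} Q` is the pull-back of `X_{e₀} → A_{e₀} ← Q` via
`ψ_{b₀}^X : b₀^* X_u ⥲ X_{e₀}`. [cite: MochizukiSemiAnbd2006, Def. 2.2(i) p.23] -/
theorem isPullback_glue (X : Over A) :
    IsPullback
      ((pullback.fst _ _ : ((𝔇.pieceV w ⋙ 𝔇.gluingAt b₁ w h₁).obj X).left ⟶ _) ≫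
        (𝒦.pull (ψ.base.branchMap b₁) (ψ.base.vertexMap w)
            (ψ.base.abuts_branchMap b₁ w h₁)).pullback.map
          (pullback.fst _ _ : ((𝔇.pieceV w).obj X).left ⟶ _) ≫
        (X.left.ψ (ψ.base.branchMap b₁) (ψ.base.vertexMap w) (ψ.base.abuts_branchMap b₁ w h₁)).hom)
      (pullback.snd _ _ : ((𝔇.pieceV w ⋙ 𝔇.gluingAt b₁ w h₁).obj X).left ⟶ _)
      ((Over.post (𝒦.ρE (𝒦.graph.edgeOf (ψ.base.branchMap b₁)))).obj X).hom
      (𝔇.cE (ℋ.graph.edgeOf b₁) (𝒦.graph.edgeOf (ψ.base.branchMap b₁))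
        (ψ.base.edgeOf_branchMap b₁).symm).1.arrow := by
  let pb := 𝒦.pull (ψ.base.branchMap b₁) (ψ.base.vertexMap w) (ψ.base.abuts_branchMap b₁ w h₁)
  haveI : PreservesFiniteLimits pb.pullback := pb.property.1
  have sq1 := pb.pullback.map_isPullback
    (IsPullback.of_hasPullback (X.hom.fS (ψ.base.vertexMap w)) (𝔇.cV w).1.arrow)
  have sq2 := IsPullback.of_hasPullback
    (pb.pullback.map (pullback.snd (X.hom.fS (ψ.base.vertexMap w)) (𝔇.cV w).1.arrow))
    (A.inclOfLE (ψ.base.abuts_branchMap b₁ w h₁) (𝔇.cV w).1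
      (𝔇.cE (ℋ.graph.edgeOf b₁) (𝒦.graph.edgeOf (ψ.base.branchMap b₁))
        (ψ.base.edgeOf_branchMap b₁).symm).1 (𝔇.le_branchImage b₁ w h₁))
  have big := sq2.paste_horiz sq1
  refine big.of_iso (Iso.refl _)
    (X.left.ψ (ψ.base.branchMap b₁) (ψ.base.vertexMap w) (ψ.base.abuts_branchMap b₁ w h₁)) (Iso.refl _)
    (A.ψ (ψ.base.branchMap b₁) (ψ.base.vertexMap w) (ψ.base.abuts_branchMap b₁ w h₁)) ?_ ?_ ?_ ?_
  · rw [Iso.refl_hom, Category.id_comp, Category.assoc]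
    rfl
  · rw [Iso.refl_hom, Iso.refl_hom, Category.id_comp, Category.comp_id]
    rfl
  · exact X.hom.comm (ψ.base.branchMap b₁) (ψ.base.vertexMap w) (ψ.base.abuts_branchMap b₁ w h₁)
  · rw [Iso.refl_hom, Category.id_comp, Category.assoc]
    exact A.inclOfLE_comp _ _ _ _

/-- The gluing isomorphism at `X → A`: `b₀^*(X_u ×_{A_u} P) ×_{b₀^* P} Q ≅ X_{e₀} ×_{A_{e₀}} Q` over `Q`.
[cite: MochizukiSemiAnbd2006, Def. 2.2(i) p.23] -/
noncomputable def glueApp (X : Over A) :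
    (𝔇.pieceV w ⋙ 𝔇.gluingAt b₁ w h₁).obj X ≅ (𝔇.pieceBr b₁).obj X :=
  Over.isoMk (𝔇.isPullback_glue b₁ w h₁ X).isoPullback
    (𝔇.isPullback_glue b₁ w h₁ X).isoPullback_hom_snd

/-- First projection of the gluing isomorphism: `pr₁ ≫ b₀^* pr₁ ≫ ψ_{b₀}^X`.
[cite: MochizukiSemiAnbd2006, Def. 2.2(i) p.23] -/
@[reassoc] theorem glueApp_hom_left_fst (X : Over A) :
    (𝔇.glueApp b₁ w h₁ X).hom.left ≫ pullback.fst _ _ =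
      (pullback.fst _ _ : ((𝔇.pieceV w ⋙ 𝔇.gluingAt b₁ w h₁).obj X).left ⟶ _) ≫
        (𝒦.pull (ψ.base.branchMap b₁) (ψ.base.vertexMap w)
            (ψ.base.abuts_branchMap b₁ w h₁)).pullback.map
          (pullback.fst _ _ : ((𝔇.pieceV w).obj X).left ⟶ _) ≫
        (X.left.ψ (ψ.base.branchMap b₁) (ψ.base.vertexMap w) (ψ.base.abuts_branchMap b₁ w h₁)).hom :=
  (𝔇.isPullback_glue b₁ w h₁ X).isoPullback_hom_fst

/-- Second projection of the gluing isomorphism: `pr₂`. [cite: MochizukiSemiAnbd2006, Def. 2.2(i) p.23] -/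
@[reassoc] theorem glueApp_hom_left_snd (X : Over A) :
    (𝔇.glueApp b₁ w h₁ X).hom.left ≫ pullback.snd _ _ =
      (pullback.snd _ _ : ((𝔇.pieceV w ⋙ 𝔇.gluingAt b₁ w h₁).obj X).left ⟶ _) :=
  (𝔇.isPullback_glue b₁ w h₁ X).isoPullback_hom_snd

/-- Naturality of the gluing isomorphisms in `X → A`. [cite: MochizukiSemiAnbd2006, Def. 2.2(i) p.23] -/
theorem glueApp_natural {X Y : Over A} (g : X ⟶ Y) :
    (𝔇.pieceV w ⋙ 𝔇.gluingAt b₁ w h₁).map g ≫ (𝔇.glueApp b₁ w h₁ Y).hom =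
      (𝔇.glueApp b₁ w h₁ X).hom ≫ (𝔇.pieceBr b₁).map g := by
  ext
  apply pullback.hom_ext
  · rw [Over.comp_left, Over.comp_left, Category.assoc, Category.assoc, glueApp_hom_left_fst,
      pieceE_map_left_fst, glueApp_hom_left_fst_assoc, Functor.comp_map,
      gluingAt_map_left_fst_assoc, ← Functor.map_comp_assoc, pieceV_map_left_fst,
      Functor.map_comp_assoc]
    erw [g.left.comm (ψ.base.branchMap b₁) (ψ.base.vertexMap w) (ψ.base.abuts_branchMap b₁ w h₁)]
  · rw [Over.comp_left, Over.comp_left, Category.assoc, Category.assoc, glueApp_hom_left_snd,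
      pieceE_map_left_snd, glueApp_hom_left_snd, Functor.comp_map, gluingAt_map_left_snd]

/-- The gluing isomorphisms, naturally in `X → A`: `pieceV ⋙ glue ≅ pieceBr`.
[cite: MochizukiSemiAnbd2006, Def. 2.2(i) p.23] -/
noncomputable def glueIso : 𝔇.pieceV w ⋙ 𝔇.gluingAt b₁ w h₁ ≅ 𝔇.pieceBr b₁ :=
  NatIso.ofComponents (fun X => 𝔇.glueApp b₁ w h₁ X) (fun g => 𝔇.glueApp_natural b₁ w h₁ g)

/-- Components of `glueIso`. [cite: MochizukiSemiAnbd2006, Def. 2.2(i) p.23] -/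
@[simp] theorem glueIso_hom_app (X : Over A) :
    (𝔇.glueIso b₁ w h₁).hom.app X = (𝔇.glueApp b₁ w h₁ X).hom := rfl

/-- The edge pieces read through `αE` do not depend on the presentation of the image edge (as
functors `Over A ⥤ ℋ_f`). [cite: MochizukiSemiAnbd2006, Def. 2.2(i) p.23] -/
theorem pieceE_comp_αE_eq (f : ℋ.graph.Edge) (e₀ : 𝒦.graph.Edge) (p : ψ.base.edgeMap f = e₀) :
    𝔇.pieceE f e₀ p ⋙ 𝔇.αE f e₀ p = 𝔇.pieceE f _ rfl ⋙ 𝔇.αE f _ rfl := by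
  subst p; rfl

/-- The gluing of the lift along `b₁`: `β`, then `αE` of the gluing square, then re-presentation of
the image edge. [cite: MochizukiSemiAnbd2006, Def. 2.2(i) p.23] -/
noncomputable def liftGlue :
    (𝔇.pieceV w ⋙ 𝔇.αV w) ⋙ (ℋ.pull b₁ w h₁).pullback ≅
      𝔇.pieceE (ℋ.graph.edgeOf b₁) _ rfl ⋙ 𝔇.αE (ℋ.graph.edgeOf b₁) _ rfl :=
  Functor.associator _ _ _ ≪≫ Functor.isoWhiskerLeft (𝔇.pieceV w) (𝔇.β b₁ w h₁) ≪≫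
    (Functor.associator _ _ _).symm ≪≫
    Functor.isoWhiskerRight (𝔇.glueIso b₁ w h₁) _ ≪≫ eqToIso (𝔇.pieceE_comp_αE_eq _ _ _)

end Branch

/-! ### The lift `B(𝒦)_{/A} ⥤ B(ℋ)` -/

/-- **The lift `Over A ⥤ B(ℋ)` of aligned local data** ([SemiAnbd] p. 23: "`B(𝒢)_{G'}` … arises
naturally as the `B(−)` of … `𝒢'`", for an abstract `ψ` with aligned local data): vertex objects
`αV_w (X_u ×_{A_u} P_w)`, edge objects `αE_f (X_e ×_{A_e} Q_f)`, glued by `liftGlue`.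
[cite: MochizukiSemiAnbd2006, Def. 2.2(i) p.23] -/
noncomputable def lift : Over A ⥤ ℋ.BObj :=
  BObj.lift (fun w => 𝔇.pieceV w ⋙ 𝔇.αV w) (fun f => 𝔇.pieceE f _ rfl ⋙ 𝔇.αE f _ rfl)
    (fun b₁ w h₁ => 𝔇.liftGlue b₁ w h₁)

/-- Vertex objects of the lift. [cite: MochizukiSemiAnbd2006, Def. 2.2(i) p.23] -/
@[simp] theorem lift_obj_S (X : Over A) (w : ℋ.graph.Vertex) :
    (𝔇.lift.obj X).S w = (𝔇.αV w).obj ((𝔇.pieceV w).obj X) := rfl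

/-- Edge objects of the lift. [cite: MochizukiSemiAnbd2006, Def. 2.2(i) p.23] -/
@[simp] theorem lift_obj_T (X : Over A) (f : ℋ.graph.Edge) :
    (𝔇.lift.obj X).T f = (𝔇.αE f _ rfl).obj ((𝔇.pieceE f _ rfl).obj X) := rfl

/-- Vertex components of lifted morphisms. [cite: MochizukiSemiAnbd2006, Def. 2.2(i) p.23] -/
@[simp] theorem lift_map_fS {X Y : Over A} (g : X ⟶ Y) (w : ℋ.graph.Vertex) :
    (𝔇.lift.map g).fS w = (𝔇.αV w).map ((𝔇.pieceV w).map g) := rfl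

/-- Edge components of lifted morphisms. [cite: MochizukiSemiAnbd2006, Def. 2.2(i) p.23] -/
@[simp] theorem lift_map_fT {X Y : Over A} (g : X ⟶ Y) (f : ℋ.graph.Edge) :
    (𝔇.lift.map g).fT f = (𝔇.αE f _ rfl).map ((𝔇.pieceE f _ rfl).map g) := rfl

/-- The lift restricts to the vertex components: `lift ⋙ ρ_w = pieceV_w ⋙ αV_w`.
[cite: MochizukiSemiAnbd2006, Def. 2.2(i) p.23] -/
theorem lift_comp_ρ (w : ℋ.graph.Vertex) : 𝔇.lift ⋙ ℋ.ρ w = 𝔇.pieceV w ⋙ 𝔇.αV w := rfl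

/-- The lift restricts to the edge components: `lift ⋙ ρ_f = pieceE_f ⋙ αE_f`.
[cite: MochizukiSemiAnbd2006, Def. 2.2(i) p.23] -/
theorem lift_comp_ρE (f : ℋ.graph.Edge) : 𝔇.lift ⋙ ℋ.ρE f = 𝔇.pieceE f _ rfl ⋙ 𝔇.αE f _ rfl := rfl

/-- The gluing isomorphisms of the lift are the components of `liftGlue`.
[cite: MochizukiSemiAnbd2006, Def. 2.2(i) p.23] -/
theorem lift_obj_ψ (X : Over A) (b₁ : ℋ.graph.Branch) (w : ℋ.graph.Vertex)
    (h₁ : ℋ.graph.abuts b₁ = some w) :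
    (𝔇.lift.obj X).ψ b₁ w h₁ = (𝔇.liftGlue b₁ w h₁).app X := rfl

/-- The gluing isomorphism of the lift along `b₁`, unfolded at a presentation-free level: `β` at the
vertex piece, then `αE` of the gluing square, then the re-presentation `eqToHom`.
[cite: MochizukiSemiAnbd2006, Def. 2.2(i) p.23] -/
theorem lift_obj_ψ_hom (X : Over A) (b₁ : ℋ.graph.Branch) (w : ℋ.graph.Vertex)
    (h₁ : ℋ.graph.abuts b₁ = some w) :
    ((𝔇.lift.obj X).ψ b₁ w h₁).hom =
      (𝔇.β b₁ w h₁).hom.app ((𝔇.pieceV w).obj X) ≫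
        (𝔇.αE (ℋ.graph.edgeOf b₁) (𝒦.graph.edgeOf (ψ.base.branchMap b₁))
            (ψ.base.edgeOf_branchMap b₁).symm).map (𝔇.glueApp b₁ w h₁ X).hom ≫
          (eqToIso (𝔇.pieceE_comp_αE_eq (ℋ.graph.edgeOf b₁)
            (𝒦.graph.edgeOf (ψ.base.branchMap b₁)) (ψ.base.edgeOf_branchMap b₁).symm)).hom.app X := by
  rw [lift_obj_ψ, Iso.app_hom]
  simp only [liftGlue, Iso.trans_hom, NatTrans.comp_app, Functor.associator_hom_app,
    Functor.isoWhiskerLeft_hom, Functor.whiskerLeft_app, Iso.symm_hom, Functor.associator_inv_app,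
    Functor.isoWhiskerRight_hom, Functor.whiskerRight_app, glueIso_hom_app, eqToIso.hom,
    Category.id_comp]

end Hom.AlignedLocalData

end SemiGraphOfAnabelioids

end Literature.AnabelianGeometry.SemiGraphs
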